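import Literature.Barriers.Parity.SiegelZeroPrimePairsMainTermBoxes
import HarnessLib

/-!
# Matomäki–Merikoski §7, main term of `Σ̃_{L,L}`: summing the boxes (roles of `M_j`, `N_j` interchanged)

Sibling of `SiegelZeroPrimePairsMainTermBoxes.lean` (the `Σ̃_{S,S}` case).  Everything here is PROVED
(theorems only; pure algebra of finite sums).  For `Σ̃_{L,L}` (arXiv:2112.11412, p. 21) Proposition 2.3 is
applied "with the roles of `M_j` and `N_j` interchanged", and its main term evaluates the same weight
`f_{M₁,M₂}` (`boxWeight`) at `(y/(M₁n₁), (y+h)/(M₂n₂), n₁/N₁, n₂/N₂)`; there `x₁y₁ = y/X`, `y₁N₁ = n₁`,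
`y₂N₂ = n₂`, the factors `F(y/(M₁n₁))`, `F((y+h)/(M₂n₂))` are the `L`-type cutoffs in `n₁`, `n₂`
(`SiegelZeroPrimePairsMainTermDyadicL.lean`), and `𝔥(n_j/N_j) = 1` on the support.  Hence, pointwise in `y`
(last display before "Similarly to the case of `Σ_{S,S}`" on p. 21):

  `∑_{i₁,i₂} ∑_{n₁ ≤ L₁, n₂ ≤ L₂} c₁(n₁)c₂(n₂)/(n₁n₂) f_{M₁,M₂}(y/(M₁n₁), (y+h)/(M₂n₂), n₁/N₁, n₂/N₂)`
  `= g(y/X)/log²X · (∑_{n₁} c₁(n₁) log(1/n₁) W'₁(n₁)/n₁) · (∑_{n₂} c₂(n₂) log(1/n₂) W'₂(n₂)/n₂)`,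

with `W'₁(n) = ∑_{i₁} F((y/n)/2^{i₁})`, `W'₂(n) = ∑_{i₂} F(((y+h)/n)/2^{i₂})` (`MatomakiMerikoski.boxSumL_pointwise_eq`;
we write `log n₁ log n₂ = log(1/n₁) log(1/n₂)` to match "Lemma 2.4 with `y = 1`").

## References

* K. Matomäki, J. Merikoski, IMRN 2023:23, 20337–20384 (arXiv:2112.11412), §7, p. 21 (the displays for
  `Σ_{L,L}`). [cite: MatomakiMerikoski2023, §7 (main term of Σ_{L,L})]
-/

noncomputable section

open Finset

namespace Literature.Barriers.Parity.MatomakiMerikoski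

open Literature.NumberTheory.Sieve

/-- **One term, `L`-type.**  For `X > 0`, `h ≥ 0`, `y`, integers `n₁, n₂ ≥ 1`, `M_j = 2^{i_j}`, `N₁ = X/M₁`,
`N₂ = (X+h)/M₂`: if `g` vanishes outside `[1,2]` and `𝔥 ≡ 1` on `[1/20, 20]`, then
`f_{M₁,M₂}(y/(M₁n₁), (y+h)/(M₂n₂), n₁/N₁, n₂/N₂) = g(y/X) F((y/n₁)/M₁) F(((y+h)/n₂)/M₂) log n₁ log n₂/log²X`.
[cite: MatomakiMerikoski2023, §7 (main term of Σ_{L,L})] -/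
theorem boxWeight_applyL_eq {g 𝔥 : ℝ → ℝ} (hg : ∀ t, g t ≠ 0 → 1 ≤ t ∧ t ≤ 2)
    (h𝔥 : ∀ t, 1 / 20 ≤ t → t ≤ 20 → 𝔥 t = 1) {X h : ℝ} (hX : 0 < X) (hh : 0 ≤ h) (i₁ i₂ : ℤ) (y : ℝ)
    {n₁ n₂ : ℕ} (hn₁ : 1 ≤ n₁) (hn₂ : 1 ≤ n₂) :
    boxWeight g 𝔥 X h i₁ i₂ ((y / n₁) / (2 : ℝ) ^ i₁) (((y + h) / n₂) / (2 : ℝ) ^ i₂)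
        ((n₁ : ℝ) * (2 : ℝ) ^ i₁ / X) ((n₂ : ℝ) * (2 : ℝ) ^ i₂ / (X + h)) =
      g (y / X) * dyadicBump ((y / n₁) / (2 : ℝ) ^ i₁) * dyadicBump (((y + h) / n₂) / (2 : ℝ) ^ i₂) *
        (Real.log n₁ * Real.log n₂) / Real.log X ^ 2 := by
  have hM₁ : (0 : ℝ) < (2 : ℝ) ^ i₁ := zpow_pos two_pos _
  have hM₂ : (0 : ℝ) < (2 : ℝ) ^ i₂ := zpow_pos two_pos _
  have hn₁0 : (0 : ℝ) < n₁ := by exact_mod_cast hn₁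
  have hn₂0 : (0 : ℝ) < n₂ := by exact_mod_cast hn₂
  have hXh : 0 < X + h := by linarith
  rw [boxWeight_def]
  have e1 : (y / n₁) / (2 : ℝ) ^ i₁ * ((n₁ : ℝ) * (2 : ℝ) ^ i₁ / X) = y / X := by field_simp
  have e2 : (n₁ : ℝ) * (2 : ℝ) ^ i₁ / X * (X / (2 : ℝ) ^ i₁) = n₁ := by field_simp
  have e3 : (n₂ : ℝ) * (2 : ℝ) ^ i₂ / (X + h) * ((X + h) / (2 : ℝ) ^ i₂) = n₂ := by field_simp
  rw [e1, e2, e3]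
  by_cases h0 : g (y / X) * dyadicBump ((y / n₁) / (2 : ℝ) ^ i₁) *
      dyadicBump (((y + h) / n₂) / (2 : ℝ) ^ i₂) = 0
  · have eL : g (y / X) * dyadicBump ((y / n₁) / (2 : ℝ) ^ i₁) * dyadicBump (((y + h) / n₂) / (2 : ℝ) ^ i₂) *
        𝔥 ((n₁ : ℝ) * (2 : ℝ) ^ i₁ / X) * 𝔥 ((n₂ : ℝ) * (2 : ℝ) ^ i₂ / (X + h)) *
        (Real.log n₁ * Real.log n₂) / Real.log X ^ 2 =
        (g (y / X) * dyadicBump ((y / n₁) / (2 : ℝ) ^ i₁) * dyadicBump (((y + h) / n₂) / (2 : ℝ) ^ i₂)) *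
          (𝔥 ((n₁ : ℝ) * (2 : ℝ) ^ i₁ / X) * 𝔥 ((n₂ : ℝ) * (2 : ℝ) ^ i₂ / (X + h)) *
          (Real.log n₁ * Real.log n₂) / Real.log X ^ 2) := by ring
    have eR : g (y / X) * dyadicBump ((y / n₁) / (2 : ℝ) ^ i₁) * dyadicBump (((y + h) / n₂) / (2 : ℝ) ^ i₂) *
        (Real.log n₁ * Real.log n₂) / Real.log X ^ 2 =
        (g (y / X) * dyadicBump ((y / n₁) / (2 : ℝ) ^ i₁) * dyadicBump (((y + h) / n₂) / (2 : ℝ) ^ i₂)) *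
          ((Real.log n₁ * Real.log n₂) / Real.log X ^ 2) := by ring
    rw [eL, eR, h0, zero_mul, zero_mul]
  · have hg0 : g (y / X) ≠ 0 := fun h' => h0 (by rw [h']; ring)
    have hF1 : dyadicBump ((y / n₁) / (2 : ℝ) ^ i₁) ≠ 0 := fun h' => h0 (by rw [h']; ring)
    have hF2 : dyadicBump (((y + h) / n₂) / (2 : ℝ) ^ i₂) ≠ 0 := fun h' => h0 (by rw [h']; ring)
    obtain ⟨hy1, hy2⟩ := hg (y / X) hg0
    have hr1 := support_dyadicBump_subset (Function.mem_support.mpr hF1)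
    have hr2 := support_dyadicBump_subset (Function.mem_support.mpr hF2)
    rw [Set.mem_Ioo] at hr1 hr2
    obtain ⟨ha1, ha2⟩ := hr1
    obtain ⟨hb1, hb2⟩ := hr2
    have hyX : X ≤ y := by rwa [le_div_iff₀ hX, one_mul] at hy1
    have hyX2 : y ≤ 2 * X := by rwa [div_le_iff₀ hX] at hy2
    -- `n₁ M₁ ∈ (y/4, y)` and `n₂ M₂ ∈ ((y+h)/4, y+h)`
    have hq1 : 0 < (n₁ : ℝ) * (2 : ℝ) ^ i₁ := by positivity
    have hq2 : 0 < (n₂ : ℝ) * (2 : ℝ) ^ i₂ := by positivity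
    rw [div_div, lt_div_iff₀ hq1] at ha1
    rw [div_div, div_lt_iff₀ hq1] at ha2
    rw [div_div, lt_div_iff₀ hq2] at hb1
    rw [div_div, div_lt_iff₀ hq2] at hb2
    have h𝔥1 : 𝔥 ((n₁ : ℝ) * (2 : ℝ) ^ i₁ / X) = 1 := by
      refine h𝔥 _ ?_ ?_
      · rw [le_div_iff₀ hX]; nlinarith
      · rw [div_le_iff₀ hX]; nlinarith
    have h𝔥2 : 𝔥 ((n₂ : ℝ) * (2 : ℝ) ^ i₂ / (X + h)) = 1 := by
      refine h𝔥 _ ?_ ?_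
      · rw [le_div_iff₀ hXh]; nlinarith
      · rw [div_le_iff₀ hXh]; nlinarith
    rw [h𝔥1, h𝔥2, mul_one, mul_one]

/-- **Summing the boxes, `L`-type** (pointwise in `y`): with `W'₁(n) = ∑_{a₁ ≤ i ≤ B₁} F((y/n)/2^i)` and
`W'₂(n) = ∑_{a₂ ≤ i ≤ B₂} F(((y+h)/n)/2^i)`,
`∑_{i₁,i₂} ∑_{n₁ ≤ L₁, n₂ ≤ L₂} c₁(n₁)c₂(n₂)/(n₁n₂) f_{M₁,M₂}(y/(M₁n₁), (y+h)/(M₂n₂), n₁/N₁, n₂/N₂)`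
`= g(y/X)/log²X · (∑_{n₁} c₁(n₁) log(1/n₁) W'₁(n₁)/n₁) · (∑_{n₂} c₂(n₂) log(1/n₂) W'₂(n₂)/n₂)`.
[cite: MatomakiMerikoski2023, §7 (main term of Σ_{L,L}, p. 21)] -/
theorem boxSumL_pointwise_eq {g 𝔥 : ℝ → ℝ} (hg : ∀ t, g t ≠ 0 → 1 ≤ t ∧ t ≤ 2)
    (h𝔥 : ∀ t, 1 / 20 ≤ t → t ≤ 20 → 𝔥 t = 1) {X h : ℝ} (hX : 0 < X) (hh : 0 ≤ h) (a₁ B₁ a₂ B₂ : ℤ)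
    (L₁ L₂ : ℕ) (c₁ c₂ : ℕ → ℝ) (y : ℝ) :
    ∑ i₁ ∈ Finset.Icc a₁ B₁, ∑ i₂ ∈ Finset.Icc a₂ B₂, ∑ n₁ ∈ Icc 1 L₁, ∑ n₂ ∈ Icc 1 L₂,
        c₁ n₁ * c₂ n₂ / ((n₁ : ℝ) * n₂) *
          boxWeight g 𝔥 X h i₁ i₂ ((y / n₁) / (2 : ℝ) ^ i₁) (((y + h) / n₂) / (2 : ℝ) ^ i₂)
            ((n₁ : ℝ) * (2 : ℝ) ^ i₁ / X) ((n₂ : ℝ) * (2 : ℝ) ^ i₂ / (X + h)) =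
      g (y / X) / Real.log X ^ 2 *
        ((∑ n₁ ∈ Icc 1 L₁, c₁ n₁ * Real.log (1 / (n₁ : ℝ)) / n₁ *
            ∑ i₁ ∈ Finset.Icc a₁ B₁, dyadicBump ((y / n₁) / (2 : ℝ) ^ i₁)) *
          ∑ n₂ ∈ Icc 1 L₂, c₂ n₂ * Real.log (1 / (n₂ : ℝ)) / n₂ *
            ∑ i₂ ∈ Finset.Icc a₂ B₂, dyadicBump (((y + h) / n₂) / (2 : ℝ) ^ i₂)) := by
  -- termwise evaluation (with `log n₁ log n₂ = log(1/n₁) log(1/n₂)`)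
  have hterm : ∀ i₁ i₂ : ℤ, ∀ n₁ ∈ Icc 1 L₁, ∀ n₂ ∈ Icc 1 L₂,
      c₁ n₁ * c₂ n₂ / ((n₁ : ℝ) * n₂) *
          boxWeight g 𝔥 X h i₁ i₂ ((y / n₁) / (2 : ℝ) ^ i₁) (((y + h) / n₂) / (2 : ℝ) ^ i₂)
            ((n₁ : ℝ) * (2 : ℝ) ^ i₁ / X) ((n₂ : ℝ) * (2 : ℝ) ^ i₂ / (X + h)) =
        g (y / X) / Real.log X ^ 2 *
          ((c₁ n₁ * Real.log (1 / (n₁ : ℝ)) / n₁ * dyadicBump ((y / n₁) / (2 : ℝ) ^ i₁)) *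
            (c₂ n₂ * Real.log (1 / (n₂ : ℝ)) / n₂ * dyadicBump (((y + h) / n₂) / (2 : ℝ) ^ i₂))) := by
    intro i₁ i₂ n₁ hn₁ n₂ hn₂
    rw [mem_Icc] at hn₁ hn₂
    rw [boxWeight_applyL_eq hg h𝔥 hX hh i₁ i₂ y hn₁.1 hn₂.1, one_div, one_div, Real.log_inv, Real.log_inv]
    have hn₁0 : (n₁ : ℝ) ≠ 0 := Nat.cast_ne_zero.mpr (by omega)
    have hn₂0 : (n₂ : ℝ) ≠ 0 := Nat.cast_ne_zero.mpr (by omega)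
    field_simp
  set α : ℕ → ℤ → ℝ := fun n₁ i₁ =>
    c₁ n₁ * Real.log (1 / (n₁ : ℝ)) / n₁ * dyadicBump ((y / n₁) / (2 : ℝ) ^ i₁) with hα
  set β : ℕ → ℤ → ℝ := fun n₂ i₂ =>
    c₂ n₂ * Real.log (1 / (n₂ : ℝ)) / n₂ * dyadicBump (((y + h) / n₂) / (2 : ℝ) ^ i₂) with hβ
  set K : ℝ := g (y / X) / Real.log X ^ 2 with hK
  have step1 : ∑ i₁ ∈ Finset.Icc a₁ B₁, ∑ i₂ ∈ Finset.Icc a₂ B₂, ∑ n₁ ∈ Icc 1 L₁, ∑ n₂ ∈ Icc 1 L₂,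
        c₁ n₁ * c₂ n₂ / ((n₁ : ℝ) * n₂) *
          boxWeight g 𝔥 X h i₁ i₂ ((y / n₁) / (2 : ℝ) ^ i₁) (((y + h) / n₂) / (2 : ℝ) ^ i₂)
            ((n₁ : ℝ) * (2 : ℝ) ^ i₁ / X) ((n₂ : ℝ) * (2 : ℝ) ^ i₂ / (X + h)) =
      ∑ i₁ ∈ Finset.Icc a₁ B₁, ∑ i₂ ∈ Finset.Icc a₂ B₂,
        K * ((∑ n₁ ∈ Icc 1 L₁, α n₁ i₁) * ∑ n₂ ∈ Icc 1 L₂, β n₂ i₂) := by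
    refine sum_congr rfl fun i₁ _ => sum_congr rfl fun i₂ _ => ?_
    rw [sum_mul_sum, mul_sum]
    refine sum_congr rfl fun n₁ hn₁ => ?_
    rw [mul_sum]
    refine sum_congr rfl fun n₂ hn₂ => ?_
    rw [hterm i₁ i₂ n₁ hn₁ n₂ hn₂]
  rw [step1]
  have step2 : ∑ i₁ ∈ Finset.Icc a₁ B₁, ∑ i₂ ∈ Finset.Icc a₂ B₂,
        K * ((∑ n₁ ∈ Icc 1 L₁, α n₁ i₁) * ∑ n₂ ∈ Icc 1 L₂, β n₂ i₂) =
      K * ((∑ i₁ ∈ Finset.Icc a₁ B₁, ∑ n₁ ∈ Icc 1 L₁, α n₁ i₁) *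
        ∑ i₂ ∈ Finset.Icc a₂ B₂, ∑ n₂ ∈ Icc 1 L₂, β n₂ i₂) := by
    rw [sum_mul_sum, mul_sum]
    refine sum_congr rfl fun i₁ _ => ?_
    rw [mul_sum]
  rw [step2, sum_comm (s := Finset.Icc a₁ B₁), sum_comm (s := Finset.Icc a₂ B₂)]
  congr 1
  congr 1
  · refine sum_congr rfl fun n₁ _ => ?_
    rw [mul_sum]
  · refine sum_congr rfl fun n₂ _ => ?_
    rw [mul_sum]

end Literature.Barriers.Parity.MatomakiMerikoski
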